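import Literature.NumberTheory.LFunctions.DedekindZeta1LogFreeMiddleRangeAllDegrees
import Literature.NumberTheory.LFunctions.LogFreeLargeRangeAllDegrees
import HarnessLib

/-!
# The log-free zero-density estimate for the Dedekind zeta function — every degree, uniformly in the field

Topic `Literature/NumberTheory/LFunctions`, namespace `Literature.NumberTheory.LFunctions.NumberField`.
Everything here is PROVED (theorems only; no definitions, no named facts).

The tree proves the log-free zero-density estimate for `ζ_K` (Bombieri's Théorème 14 for `ζ₁_K = (s−1)ζ_K`,
uniformly in the number field, with a size parameter `P` dominating `|d_K|`, `h_K`, `1/κ_K` and the heights)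
for degree `n ≤ 2` (`logFreeDensity_dedekindZeta₁`) and `n ≤ 3` (`logFreeDensity_dedekindZeta₁_of_le_three`).
The degree restriction was purely numerical.  With the all-degree middle range (`middleRange_Z1_of_le`) and
the trivial range with the degree-dependent height bound (`largeRange_Z1_of_le` of
`LogFreeLargeRangeAllDegrees.lean`, cell B2b-1 PART B), the assembly of the tree (small range `smallRange_Z1` =
Landau–Page for `ζ_K`, any degree) gives

* `logFreeDensity_dedekindZeta₁_all (n)` — **the log-free zero-density estimate for `ζ_K` in EVERY degree**:
  `Σ_{ρ ∈ Z, β ≥ α} m(ρ) ≤ C_D P^{c_D(1−α)}`, EXACTLY the shape of `logFreeDensity_dedekindZeta₁ n hn`.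

This is the `χ = 1` member (with the pole term) of Weiss 1983 Thm. 4.3 / Thorner–Zaman 2019 Thm. 3.2 without
the Deuring–Heilbronn factor `B₁`, in every degree.

## References

* [Bombieri1987GrandCrible] E. Bombieri, Astérisque 18 (1987), §6 Théorème 14 (the case of `ζ`).
* [ThornerZaman2017] J. Thorner, A. Zaman, Algebra Number Theory 11 (2017), Theorem 5.3.
* [ThornerZaman2019] J. Thorner, A. Zaman, *A unified and improved Chebotarev density theorem*, Algebra Number
  Theory 13 (2019) 1039–1068, Thm. 3.2 (arXiv:1803.02823, §3).
* [Weiss1983] A. Weiss, *The least prime ideal*, J. reine angew. Math. 338 (1983) 56–94, Thm. 4.3.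
-/

noncomputable section

open Complex Finset Filter Real MeasureTheory
open scoped LSeries.notation ArithmeticFunction.vonMangoldt Topology Nat

namespace Literature.NumberTheory.LFunctions.NumberField

open Literature.NumberTheory.LFunctions.LogFreeLocal Literature.NumberTheory.LFunctions.LogFreeDensity
  Literature.NumberTheory.LFunctions.AbelianDensity
open scoped nonZeroDivisors _root_.NumberField

open scoped Classical in
/-- **The log-free zero-density estimate for `ζ_K`, every degree** (Bombieri's Théorème 14 for the trivial
class group character; Weiss 1983 Thm. 4.3; Thorner–Zaman 2017 Theorem 5.3 with `δ(χ) = 1`; the `χ = 1`,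
`B₁ = 1` case of Thorner–Zaman 2019 Theorem 3.2 for the Hilbert class field): for every degree `n` there are
`c_D, C_D > 0` such that for every number field `K` of degree `n`, every `P ≥ 2` with `|d_K| ≤ P`, `h_K ≤ P`,
`κ_K ≥ 1/P`, every finite set `Z` of zeros of `ζ_K` with `1/4 ≤ β < 1`, `|γ| ≤ P`, and all `0 ≤ α ≤ 1`:
`Σ_{ρ ∈ Z, β ≥ α} m(ρ) ≤ C_D P^{c_D(1−α)}` — EXACTLY the shape of the tree's `logFreeDensity_dedekindZeta₁ n (n ≤ 2)`
and `logFreeDensity_dedekindZeta₁_of_le_three n (n ≤ 3)`, with the degree hypothesis removed.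
[cite: ThornerZaman2019, Thm. 3.2] -/
theorem logFreeDensity_dedekindZeta₁_all (n : ℕ) :
    ∃ c_D C_D : ℝ, 0 < c_D ∧ 0 < C_D ∧
      ∀ (K : Type) [Field K] [NumberField K], Module.finrank ℚ K = n →
        ∀ P : ℝ, 2 ≤ P → ((NumberField.discr K).natAbs : ℝ) ≤ P →
          (Fintype.card (ClassGroup (𝓞 K)) : ℝ) ≤ P → P⁻¹ ≤ NumberField.dedekindZeta_residue K →
        ∀ Z : Finset ℂ, (∀ ρ ∈ Z, dedekindZeta₁ K ρ = 0 ∧ 1 / 4 ≤ ρ.re ∧ ρ.re < 1 ∧ |ρ.im| ≤ P) →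
          ∀ α : ℝ, 0 ≤ α → α ≤ 1 →
            ∑ ρ ∈ Z with α ≤ ρ.re, (zeroOrder (dedekindZeta₁ K) ρ : ℝ) ≤ C_D * P ^ (c_D * (1 - α)) := by
  obtain ⟨c₁, hc₁, hsmall⟩ := smallRange_Z1 n
  obtain ⟨δ₀, A, C, hδ₀, hA, hC, hmid⟩ := middleRange_Z1_of_le n hc₁
  obtain ⟨C₃, hC₃, hlarge⟩ := largeRange_Z1_of_le n
  refine ⟨max A (2 / δ₀), max (max 1 C) C₃, by positivity, by positivity,
    fun K _ _ hK P hP hd hh hκ Z hZ α hα0 hα1 => ?_⟩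
  have hnK : Module.finrank ℚ K ≤ n := hK.le
  have hP1 : 1 ≤ P := by linarith
  have hexp0 : 0 ≤ max A (2 / δ₀) * (1 - α) := mul_nonneg (by positivity) (by linarith)
  have hPpow1 : 1 ≤ P ^ (max A (2 / δ₀) * (1 - α)) := Real.one_le_rpow hP1 hexp0
  rcases lt_or_ge (1 - α) (c₁ / Real.log P) with h1 | h1
  · refine (hsmall K hK P hP hd Z (fun ρ hρ ↦ ⟨(hZ ρ hρ).1, (hZ ρ hρ).2.2.2⟩) α h1).trans ?_
    calc (1 : ℝ) ≤ max (max 1 C) C₃ * 1 := by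
          have : (1:ℝ) ≤ max (max 1 C) C₃ := (le_max_left _ _).trans' (le_max_left _ _)
          linarith
      _ ≤ _ := mul_le_mul_of_nonneg_left hPpow1 (by positivity)
  rcases le_or_gt (1 - α) δ₀ with h2 | h2
  · refine (hmid K hnK P hP hd hh hκ Z (fun ρ hρ ↦ ?_) α h1 h2).trans ?_
    · obtain ⟨h0, hβ, hβ1, him⟩ := hZ ρ hρ
      exact ⟨h0, by linarith, hβ1, him⟩
    refine mul_le_mul ((le_max_right _ _).trans (le_max_left _ _)) ?_ (by positivity) (by positivity)
    exact Real.rpow_le_rpow_of_exponent_le hP1 (mul_le_mul_of_nonneg_right (le_max_left _ _) (by linarith))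
  · have hsub : ∑ ρ ∈ Z with α ≤ ρ.re, (zeroOrder (dedekindZeta₁ K) ρ : ℝ) ≤
        ∑ ρ ∈ Z, (zeroOrder (dedekindZeta₁ K) ρ : ℝ) :=
      sum_le_sum_of_subset_of_nonneg (filter_subset _ _) fun ρ _ _ => Nat.cast_nonneg _
    refine hsub.trans ((hlarge K hnK P hP hd Z (fun ρ hρ ↦ ?_)).trans ?_)
    · obtain ⟨h0, hβ, hβ1, him⟩ := hZ ρ hρ
      exact ⟨h0, hβ, hβ1.le, him⟩
    refine mul_le_mul (le_max_right _ _) ?_ (by positivity) (by positivity)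
    rw [← Real.rpow_natCast]
    refine Real.rpow_le_rpow_of_exponent_le hP1 ?_
    push_cast
    have : (2 : ℝ) ≤ 2 / δ₀ * (1 - α) := by
      rw [div_mul_eq_mul_div, le_div_iff₀ hδ₀]; nlinarith
    exact this.trans (mul_le_mul_of_nonneg_right (le_max_right _ _) (by linarith))

end Literature.NumberTheory.LFunctions.NumberField

end
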